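import Summits.QuantumAdvantage.QuantumAdvantage.Theses.MobiusLadder
import Summits.PneNP.Statement
import Literature.Computability.QuantumComplexity.FactoringProofs
import Literature.Computability.Complexity.PPolyComplement
import Literature.Computability.Complexity.CircuitClassesUniformProofs
import Literature.Computability.Complexity.CookBridges

/-!
# The crux `LiouvilleNotPPoly` is a separation statement: `L_λ ∈ NP ∩ coNP`

Helper file for the crux `MobiusLadder.LiouvilleNotPPoly` (stmt-QuantumAdvantage-1389), line
`SketchIdeator2` (root-number transfer; complete modulo its apex `stub_algRootSignHard`). It
kernel-checks the STATUS of crux and apex (planner memo B3, so far prose): `L_λ = bin {N : λ(N) = −1}`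
(Mathlib's LSB-first `encodeNat`) and its twin `bin {N : λ(N) = +1}` are in `NP ∩ coNP` —
certificate of `⌜N⌝`, `N ≥ 1`: the prime factorisation WITH MULTIPLICITY plus Pratt certificates
(`FactCoNP.factCert`), checked by a brick-assembled polynomial-time verifier that also tests the
PARITY of the number of listed primes (a fold brick); soundness is unique factorisation (a list of
primes with product `N` has length `Ω(N)`) and `λ(N) = (−1)^{Ω(N)}`. Hence the crux implies
`NP ⊄ P/poly`, `P ≠ NP`, and the summit `PneNP` with `L_λ` as Cook's witness
(`pneNP_of_liouvilleNotPPoly`): the apex, once promoted, is an item of Karp–Lipton strength and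
`Literature.Barriers.QuantumAdvantage.SeparationPrerequisites` applies to it as to the crux. No
definition is introduced (verifiers are closed brick terms, packaged existentially).

References: V. Pratt, SIAM J. Comput. 4 (1975) 214–220; S. Arora, B. Barak, *Computational
Complexity* (2009), Def. 2.1, Def. 2.19, Example 2.3, §6.1; L. Adleman, K. McCurley, *Open problems
in number theoretic complexity II*, LNCS 877 (1994); S. Cook, Clay problem description §1.
-/

noncomputable section

set_option linter.dupNamespace false

namespace Summit.QuantumAdvantage.QuantumAdvantage.Theorems.LiouvilleNotPPoly

open _root_.Computability Polynomial
open Literature.Computability.Complexity Literature.Computability.Complexity.Classes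
  Literature.Computability.Complexity.Nondeterministic Literature.Computability.Complexity.Brick
open Literature.NumberTheory.Primality
open Literature.Computability.QuantumComplexity Literature.Computability.QuantumComplexity.PrattMachine
open Summit.QuantumAdvantage.QuantumAdvantage.Theses.MobiusLadder (LiouvilleNotPPoly)

/-! ### Arithmetic of the certificates: a prime factorisation with multiplicity determines `λ` -/

/-- A list of primes with product `N` has length `Ω(N)` (unique factorisation). -/
theorem length_eq_cardFactors_of_prod_eq {N : ℕ} {l : List ℕ} (hprod : l.prod = N)
    (hl : ∀ p ∈ l, p.Prime) : l.length = ArithmeticFunction.cardFactors N := by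
  rw [ArithmeticFunction.cardFactors_apply]
  exact (Nat.primeFactorsList_unique hprod hl).length_eq

/-- `λ(N) = −1 ↔ Ω(N)` is odd (`N ≠ 0`). -/
theorem liouville_eq_neg_one_iff_odd {N : ℕ} (hN : N ≠ 0) :
    ArithmeticFunction.liouville N = -1 ↔ Odd (ArithmeticFunction.cardFactors N) := by
  rw [ArithmeticFunction.liouville_apply hN]
  constructor
  · intro h
    by_contra hodd
    rw [Nat.not_odd_iff_even] at hodd
    rw [hodd.neg_one_pow] at h
    norm_num at h
  · intro h
    exact h.neg_one_pow

/-- `λ(N) = 1 ↔ Ω(N)` is even (`N ≠ 0`). -/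
theorem liouville_eq_one_iff_even {N : ℕ} (hN : N ≠ 0) :
    ArithmeticFunction.liouville N = 1 ↔ Even (ArithmeticFunction.cardFactors N) := by
  rw [ArithmeticFunction.liouville_apply hN]
  constructor
  · intro h
    by_contra hev
    rw [Nat.not_even_iff_odd] at hev
    rw [hev.neg_one_pow] at h
    norm_num at h
  · intro h
    exact h.neg_one_pow

/-- For `N ≠ 0`: `λ(N) = (if par then −1 else 1)` iff `decide (Odd Ω(N)) = par`. -/
theorem liouville_eq_sign_iff {N : ℕ} (hN : N ≠ 0) (par : Bool) :
    ArithmeticFunction.liouville N = (if par then -1 else 1) ↔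
      decide (Odd (ArithmeticFunction.cardFactors N)) = par := by
  cases par
  · simp only [Bool.false_eq_true, ↓reduceIte, decide_eq_false_iff_not, Nat.not_odd_iff_even]
    exact liouville_eq_one_iff_even hN
  · simp only [↓reduceIte, decide_eq_true_eq]
    exact liouville_eq_neg_one_iff_odd hN

/-! ### The parity-of-length brick (a two-line fold) -/

/-- The flip fold: folding `acc ↦ [¬(acc = [1])]` from `[b]` over a list ends on `[b]` or `[¬b]`
according to the parity of the length. -/
theorem foldl_flip (l : List (List Bool)) : ∀ b : Bool,
    l.foldl (fun (acc : List Bool) (_ : List Bool) => [!decide (acc = [true])]) [b] =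
      [if Even l.length then b else !b] := by
  induction l with
  | nil => intro b; simp
  | cons a l ih =>
    intro b
    rw [List.foldl_cons]
    have hb : (!decide ([b] = [true])) = !b := by cases b <;> simp
    simp only [hb]
    rw [ih]
    by_cases h : Even l.length
    · have h' : ¬ Even (l.length + 1) := fun hn => (Nat.even_add_one.1 hn) h
      simp [h, h']
    · have h' : Even (l.length + 1) := Nat.even_add_one.2 h
      simp [h, h']

/-- **The parity-of-length brick**: an `FP` string function returning, on every input `w`, the bit
"the coded list `sndF w` has an odd number of items" — `foldFn` of the one-bit step
`⟨u, ⟨a, acc⟩⟩ ↦ [¬(acc = [1])]` from `[0]`. -/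
theorem exists_oddLen_brick :
    ∃ F : List Bool → List Bool, F ∈ FP ∧ ∀ w, F w = [decide (Odd (decNil (sndF w)).length)] := by
  refine ⟨foldFn (notFn (eqPairFn ∘ fanoutFn (sndPow 1) (fun _ => [true]))) (fun _ => [false]), ?_, ?_⟩
  · exact foldFn_mem_FP
      (notFn_mem_FP (comp_mem_FP eqPairFn_mem_FP (fanoutFn_mem_FP (sndPow_mem_FP 1) (const_mem_FP _))))
      (const_mem_FP _) (foldGrowth_of_oneBit (oneBit_notFn (oneBit_eqPairFn.comp _)))
  · intro w
    rw [foldFn_apply]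
    have hstep : (fun acc a => notFn (eqPairFn ∘ fanoutFn (sndPow 1) (fun _ => [true]))
        (boolPair w (boolPair a acc))) = fun (acc : List Bool) (_ : List Bool) => [!decide (acc = [true])] := by
      funext acc a
      refine notFn_apply ?_
      rw [Function.comp_apply, fanoutFn_apply, eqPairFn_boolPair]
      simp [sndPow]
    rw [hstep, foldl_flip]
    by_cases h : Even (decNil (sndF w)).length
    · have h' : ¬ Odd (decNil (sndF w)).length := Nat.not_odd_iff_even.mpr h
      simp [h, h']
    · have h' : Odd (decNil (sndF w)).length := Nat.not_even_iff_odd.mp h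
      simp [h, h']

/-! ### The verifier (a closed brick term, packaged with its value): on `⟨x, ⟨PL, Ls⟩⟩` accept iff
`x = ⌜N⌝`, `N ≥ 1`, `∏ PL = N`, every item of `PL` is a head of the valid Pratt certificate `Ls`,
and `#PL` has parity `par`. -/

/-- **The Liouville verifier** (`par = 1`: `λ = −1`; `par = 0`: `λ = +1`): a polynomial-time (`FP`,
by brick closure), one-bit string function with the displayed value on pairs `⟨x, y⟩`, `y` read
as `⟨PL, Ls⟩` by the total decoders. [Arora–Barak 2009, Example 2.3; Pratt 1975] -/
theorem exists_liouville_verifier (par : Bool) :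
    ∃ V : List Bool → List Bool, V ∈ FP ∧ OneBit V ∧ ∀ x y : List Bool,
      (V (boolPair x y) = [true] ↔
        x = encodeNat (bitsToNat x) ∧ 0 < bitsToNat x ∧
          ((decNil (fstF y)).map bitsToNat).prod = bitsToNat x ∧
          (∀ ps ∈ decNil (fstF y), bitsToNat ps ∈ Pratt.heads (linesOf (sndF y))) ∧
          Pratt.CertValid (linesOf (sndF y)) ∧ decide (Odd (decNil (fstF y)).length) = par) := by
  obtain ⟨F, hF, hFval⟩ := exists_oddLen_brick
  -- the six tests, on `w = ⟨x, ⟨PL, Ls⟩⟩` (`x = fstF w`, `PL = fstF (sndF w)`, `Ls = sndF (sndF w)`)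
  let cCanon : List Bool → List Bool := eqPairFn ∘ fanoutFn fstF (norm ∘ fstF)
  let cPos : List Bool → List Bool := ltFn ∘ fanoutFn (fun _ => []) fstF
  let cProd : List Bool → List Bool :=
    eqValFn ∘ fanoutFn (prodListFn ∘ fanoutFn (fun _ => []) (fstF ∘ sndF)) fstF
  let cHeads : List Bool → List Bool := allFn (memHeadFn ∘ fanoutFn sndF fstF) ∘ fanoutFn (sndF ∘ sndF) (fstF ∘ sndF)
  let cCert : List Bool → List Bool := certTestFn ∘ sndF ∘ sndF
  let cPar : List Bool → List Bool := eqPairFn ∘ fanoutFn (F ∘ fanoutFn (fun _ => []) (fstF ∘ sndF)) (fun _ => [par])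
  have oCanon : OneBit cCanon := oneBit_eqPairFn.comp _
  have oPos : OneBit cPos := oneBit_ltFn.comp _
  have oProd : OneBit cProd := oneBit_eqValFn.comp _
  have oHead1 : OneBit (memHeadFn ∘ fanoutFn sndF fstF) := oneBit_memHeadFn.comp _
  have oHeads : OneBit cHeads := (oneBit_allFn oHead1).comp _
  have oCert : OneBit cCert := oneBit_certTestFn.comp _
  have oPar : OneBit cPar := oneBit_eqPairFn.comp _
  refine ⟨andFn cCanon (andFn cPos (andFn cProd (andFn cHeads (andFn cCert cPar)))), ?_, ?_, fun x y => ?_⟩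
  · exact andFn_mem_FP (comp_mem_FP eqPairFn_mem_FP (fanoutFn_mem_FP fstF_mem_FP (comp_mem_FP norm_mem_FP fstF_mem_FP)))
      (andFn_mem_FP (comp_mem_FP ltFn_mem_FP (fanoutFn_mem_FP (const_mem_FP _) fstF_mem_FP))
      (andFn_mem_FP (comp_mem_FP eqValFn_mem_FP (fanoutFn_mem_FP
          (comp_mem_FP prodListFn_mem_FP (fanoutFn_mem_FP (const_mem_FP _) (comp_mem_FP fstF_mem_FP sndF_mem_FP))) fstF_mem_FP))
      (andFn_mem_FP (comp_mem_FP (allFn_mem_FP (comp_mem_FP memHeadFn_mem_FP (fanoutFn_mem_FP sndF_mem_FP fstF_mem_FP)) oHead1)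
          (fanoutFn_mem_FP (comp_mem_FP sndF_mem_FP sndF_mem_FP) (comp_mem_FP fstF_mem_FP sndF_mem_FP)))
      (andFn_mem_FP (comp_mem_FP certTestFn_mem_FP (comp_mem_FP sndF_mem_FP sndF_mem_FP))
        (comp_mem_FP eqPairFn_mem_FP (fanoutFn_mem_FP
          (comp_mem_FP hF (fanoutFn_mem_FP (const_mem_FP _) (comp_mem_FP fstF_mem_FP sndF_mem_FP))) (const_mem_FP _)))))))
  · exact oneBit_andFn oCanon (oneBit_andFn oPos (oneBit_andFn oProd (oneBit_andFn oHeads (oneBit_andFn oCert oPar))))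
  · rw [PrattMachine.andFn_eq_true_iff oCanon (oneBit_andFn oPos (oneBit_andFn oProd (oneBit_andFn oHeads (oneBit_andFn oCert oPar)))),
      PrattMachine.andFn_eq_true_iff oPos (oneBit_andFn oProd (oneBit_andFn oHeads (oneBit_andFn oCert oPar))),
      PrattMachine.andFn_eq_true_iff oProd (oneBit_andFn oHeads (oneBit_andFn oCert oPar)),
      PrattMachine.andFn_eq_true_iff oHeads (oneBit_andFn oCert oPar),
      PrattMachine.andFn_eq_true_iff oCert oPar]
    -- values of the six pieces on the pair `⟨x, y⟩`
    have vCanon : cCanon (boolPair x y) = [true] ↔ x = encodeNat (bitsToNat x) := by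
      simp only [cCanon, Function.comp_apply, fanoutFn_apply, fstF_boolPair, eqPairFn_boolPair, norm_eq_encodeNat,
        List.singleton_inj, decide_eq_true_eq]
    have vPos : cPos (boolPair x y) = [true] ↔ 0 < bitsToNat x := by
      simp only [cPos, Function.comp_apply, fanoutFn_apply, fstF_boolPair, ltFn_eq_true_iff, bitsToNat_nil]
    have vProd : cProd (boolPair x y) = [true] ↔ ((decNil (fstF y)).map bitsToNat).prod = bitsToNat x := by
      simp only [cProd, Function.comp_apply, fanoutFn_apply, fstF_boolPair, sndF_boolPair, eqValFn_eq_true_iff,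
        prodListFn_boolPair, bitsToNat_encodeNat]
    have vHeads : cHeads (boolPair x y) = [true] ↔
        ∀ ps ∈ decNil (fstF y), bitsToNat ps ∈ Pratt.heads (linesOf (sndF y)) := by
      simp only [cHeads, Function.comp_apply, fanoutFn_apply, fstF_boolPair, sndF_boolPair,
        allFn_eq_true_iff oHead1, memHeadFn_eq_true_iff, mem_heads_linesOf_iff]
    have vCert : cCert (boolPair x y) = [true] ↔ Pratt.CertValid (linesOf (sndF y)) := by
      simp only [cCert, Function.comp_apply, sndF_boolPair, certTestFn_eq_true_iff]
    have vPar : cPar (boolPair x y) = [true] ↔ decide (Odd (decNil (fstF y)).length) = par := by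
      simp only [cPar, Function.comp_apply, fanoutFn_apply, sndF_boolPair, hFval,
        eqPairFn_boolPair, List.singleton_inj, decide_eq_true_eq]
    rw [vCanon, vPos, vProd, vHeads, vCert, vPar]

/-! ### Soundness and completeness of the certificate -/

/-- **Soundness**: an accepted pair `⟨x, y⟩` has `x = ⌜N⌝` with `N ≥ 1` and
`λ(N) = (−1)^{par}`. -/
theorem liouville_of_verifier {par : Bool} {x y : List Bool}
    (h : x = encodeNat (bitsToNat x) ∧ 0 < bitsToNat x ∧
      ((decNil (fstF y)).map bitsToNat).prod = bitsToNat x ∧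
      (∀ ps ∈ decNil (fstF y), bitsToNat ps ∈ Pratt.heads (linesOf (sndF y))) ∧
      Pratt.CertValid (linesOf (sndF y)) ∧ decide (Odd (decNil (fstF y)).length) = par) :
    ArithmeticFunction.liouville (bitsToNat x) = (if par then -1 else 1) := by
  obtain ⟨-, hpos, hprod, hheads, hvalid, hpar⟩ := h
  have hprimes : ∀ p ∈ (decNil (fstF y)).map bitsToNat, p.Prime := by
    intro p hp
    obtain ⟨ps, hps, rfl⟩ := List.mem_map.1 hp
    exact hvalid.prime_of_mem_heads (hheads ps hps)
  rw [liouville_eq_sign_iff (Nat.pos_iff_ne_zero.1 hpos),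
    ← length_eq_cardFactors_of_prod_eq hprod hprimes, List.length_map]
  exact hpar

/-- **Completeness**: for `N ≥ 1` the certificate `factCert N` (prime factorisation with
multiplicity + Pratt certificates) passes all tests but the parity one, which reads `Odd Ω(N)`. -/
theorem verifier_factCert {N : ℕ} (hN : N ≠ 0) (par : Bool)
    (hpar : decide (Odd (ArithmeticFunction.cardFactors N)) = par) :
    encodeNat N = encodeNat (bitsToNat (encodeNat N)) ∧ 0 < bitsToNat (encodeNat N) ∧
      ((decNil (fstF (FactCoNP.factCert N))).map bitsToNat).prod = bitsToNat (encodeNat N) ∧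
      (∀ ps ∈ decNil (fstF (FactCoNP.factCert N)),
        bitsToNat ps ∈ Pratt.heads (linesOf (sndF (FactCoNP.factCert N)))) ∧
      Pratt.CertValid (linesOf (sndF (FactCoNP.factCert N))) ∧
      decide (Odd (decNil (fstF (FactCoNP.factCert N))).length) = par := by
  have hps : ∀ p ∈ N.primeFactorsList, p.Prime := fun p hp => Nat.prime_of_mem_primeFactorsList hp
  obtain ⟨hcert, hheads⟩ := certTestFn_encLines_flatMap hps
  simp only [FactCoNP.factCert, fstF_boolPair, sndF_boolPair, bitsToNat_encodeNat, decNil_encList, List.map_map,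
    List.forall_mem_map, List.length_map]
  refine ⟨trivial, Nat.pos_of_ne_zero hN, ?_, fun p hp => hheads p hp, (certTestFn_eq_true_iff _).1 hcert, ?_⟩
  · have : (bitsToNat ∘ encodeNat) = id := funext fun n => bitsToNat_encodeNat n
    rw [this, List.map_id]
    exact Nat.prod_primeFactorsList hN
  · rw [← ArithmeticFunction.cardFactors_apply]
    exact hpar

/-- The certificate is succinct: `|factCert N| ≤ factCertPoly (|⌜N⌝|)`. -/
theorem length_factCert_le_eval_encodeNat {N : ℕ} (hN : N ≠ 0) :
    (FactCoNP.factCert N).length ≤ FactCoNP.factCertPoly.eval (encodeNat N).length :=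
  FactCoNP.length_factCert_le_eval hN (by rw [TM2Pass.length_encodeNat_eq_size])

/-! ### `L_λ ∈ NP` for both signs -/

/-- **`bin {N : λ(N) = (−1)^{par}} ∈ NP`** (`par = 1`: the crux's language `L_λ`; `par = 0`: its
sign-flipped twin, the language of the route PneNP/Mobius). Certificate: the prime factorisation
with multiplicity and Pratt certificates; verifier: `exists_liouville_verifier`. [Pratt 1975;
Arora–Barak 2009, Example 2.3] -/
theorem liouvilleSign_mem_NP (par : Bool) :
    encodingNatBool.toLanguage {N : ℕ | ArithmeticFunction.liouville N = (if par then -1 else 1)} ∈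
      Nondeterministic.NP := by
  obtain ⟨V, hV, h1, hVal⟩ := exists_liouville_verifier par
  refine ⟨{z : List Bool | V z = [true]}, mem_P_of_mem_FP hV _ (fun z => ⟨id, fun hz => h1.eq_false_of_ne_true hz⟩),
    FactCoNP.factCertPoly, fun x => ?_⟩
  constructor
  · rintro ⟨N, hN, rfl⟩
    have hN' : ArithmeticFunction.liouville N = (if par then -1 else 1) := hN
    have hN0 : N ≠ 0 := by
      rintro rfl
      cases par <;> simp at hN'
    refine ⟨FactCoNP.factCert N, length_factCert_le_eval_encodeNat hN0, ?_⟩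
    show V (boolPair (encodeNat N) (FactCoNP.factCert N)) = [true]
    rw [hVal]
    exact verifier_factCert hN0 par ((liouville_eq_sign_iff hN0 par).1 hN')
  · rintro ⟨y, -, hy⟩
    change V (boolPair x y) = [true] at hy
    rw [hVal] at hy
    have hx : x = encodeNat (bitsToNat x) := hy.1
    rw [hx]
    exact ⟨bitsToNat x, liouville_of_verifier hy, rfl⟩

/-- **`L_λ = bin {N : λ(N) = −1} ∈ NP`** (the crux's language). -/
theorem liouville_mem_NP :
    encodingNatBool.toLanguage {N : ℕ | ArithmeticFunction.liouville N = -1} ∈ Nondeterministic.NP := by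
  simpa using liouvilleSign_mem_NP true

/-- **`bin {N : λ(N) = 1} ∈ NP`** (the language of PneNP/Mobius's `LiouvilleInNP`, stmt-PneNP-1111,
in this tree's classes). -/
theorem liouvillePos_mem_NP :
    encodingNatBool.toLanguage {N : ℕ | ArithmeticFunction.liouville N = 1} ∈ Nondeterministic.NP := by
  simpa using liouvilleSign_mem_NP false

/-! ### `L_λ ∈ coNP` for both signs -/

/-- **The complement of `bin {N : λ(N) = (−1)^{par}}` is in `NP`**: a non-numeral and `⌜0⌝ = ε`
have the empty certificate; `⌜N⌝` with `N ≥ 1`, `λ(N) = −(−1)^{par}` has the certificate of the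
opposite sign. Verifier: `¬canonical ∨ x = ε ∨ V_{¬par}`. [Arora–Barak 2009, Def. 2.19] -/
theorem liouvilleSign_compl_mem_NP (par : Bool) :
    (encodingNatBool.toLanguage {N : ℕ | ArithmeticFunction.liouville N = (if par then -1 else 1)})ᶜ ∈
      Nondeterministic.NP := by
  obtain ⟨V, hV, h1, hVal⟩ := exists_liouville_verifier (!par)
  have oCanon : OneBit (eqPairFn ∘ fanoutFn fstF (norm ∘ fstF)) := oneBit_eqPairFn.comp _
  have oNil : OneBit (isNilFn ∘ fstF) := oneBit_isNilFn.comp _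
  let W : List Bool → List Bool := orFn (notFn (eqPairFn ∘ fanoutFn fstF (norm ∘ fstF))) (orFn (isNilFn ∘ fstF) V)
  have hW : W ∈ FP := orFn_mem_FP (notFn_mem_FP (comp_mem_FP eqPairFn_mem_FP
      (fanoutFn_mem_FP fstF_mem_FP (comp_mem_FP norm_mem_FP fstF_mem_FP))))
    (orFn_mem_FP (comp_mem_FP isNilFn_mem_FP fstF_mem_FP) hV)
  have oW : OneBit W := oneBit_orFn (oneBit_notFn oCanon) (oneBit_orFn oNil h1)
  have hWval : ∀ x y : List Bool, W (boolPair x y) = [true] ↔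
      ¬ x = encodeNat (bitsToNat x) ∨ x = [] ∨ V (boolPair x y) = [true] := by
    intro x y
    rw [PrattMachine.orFn_eq_true_iff (oneBit_notFn oCanon) (oneBit_orFn oNil h1),
      PrattMachine.orFn_eq_true_iff oNil h1, PrattMachine.notFn_eq_true_iff oCanon]
    simp only [Function.comp_apply, fanoutFn_apply, fstF_boolPair, eqPairFn_boolPair, norm_eq_encodeNat,
      List.singleton_inj, decide_eq_true_eq, isNilFn, decide_eq_true_eq]
  refine ⟨{z : List Bool | W z = [true]}, mem_P_of_mem_FP hW _ (fun z => ⟨id, fun hz => oW.eq_false_of_ne_true hz⟩),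
    FactCoNP.factCertPoly, fun x => ?_⟩
  have hmem : ∀ N : ℕ, encodeNat N ∈
      encodingNatBool.toLanguage {N : ℕ | ArithmeticFunction.liouville N = (if par then -1 else 1)} ↔
        ArithmeticFunction.liouville N = (if par then -1 else 1) :=
    fun N => encodingNatBool.mem_toLanguage_iff _ N
  constructor
  · intro hx
    by_cases hc : x = encodeNat (bitsToNat x)
    · -- `x = ⌜N⌝`
      set N := bitsToNat x with hNdef
      rcases Nat.eq_zero_or_pos N with hN0 | hNpos
      · refine ⟨[], Nat.zero_le _, ?_⟩
        show W (boolPair x []) = [true]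
        rw [hWval]
        refine Or.inr (Or.inl ?_)
        rw [hc, hN0]; rfl
      · have hN0 : N ≠ 0 := Nat.pos_iff_ne_zero.1 hNpos
        have hne : ArithmeticFunction.liouville N ≠ (if par then -1 else 1) := fun h => hx (hc ▸ (hmem N).2 h)
        have hflip : ArithmeticFunction.liouville N = (if (!par) then -1 else 1) := by
          rw [ArithmeticFunction.liouville_apply hN0] at hne ⊢
          rcases neg_one_pow_eq_or ℤ (ArithmeticFunction.cardFactors N) with h | h <;>
            rw [h] at hne ⊢ <;> cases par <;> simp at hne ⊢
        refine ⟨FactCoNP.factCert N, ?_, ?_⟩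
        · calc (FactCoNP.factCert N).length ≤ FactCoNP.factCertPoly.eval (encodeNat N).length :=
                length_factCert_le_eval_encodeNat hN0
            _ = FactCoNP.factCertPoly.eval x.length := by rw [← hc]
        · show W (boolPair x (FactCoNP.factCert N)) = [true]
          rw [hWval]
          refine Or.inr (Or.inr ?_)
          rw [hc, hVal]
          simpa only [bitsToNat_encodeNat] using
            verifier_factCert hN0 (!par) ((liouville_eq_sign_iff hN0 (!par)).1 hflip)
    · -- `x` is not a numeral
      refine ⟨[], Nat.zero_le _, ?_⟩
      show W (boolPair x []) = [true]
      rw [hWval]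
      exact Or.inl hc
  · rintro ⟨y, -, hy⟩ hxL
    obtain ⟨N, hN, rfl⟩ := hxL
    change W (boolPair (encodeNat N) y) = [true] at hy
    have hN' : ArithmeticFunction.liouville N = (if par then -1 else 1) := hN
    rw [hWval] at hy
    rcases hy with hc | hnil | hv
    · exact hc (by rw [bitsToNat_encodeNat])
    · have hN0 : N = 0 := (encodeNat_eq_nil_iff N).1 hnil
      subst hN0
      cases par <;> simp at hN'
    · rw [hVal] at hv
      have hl := liouville_of_verifier hv
      rw [bitsToNat_encodeNat] at hl
      rw [hl] at hN'
      cases par <;> simp at hN'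

/-- **`L_λ ∈ coNP`.** -/
theorem liouville_mem_coNP :
    encodingNatBool.toLanguage {N : ℕ | ArithmeticFunction.liouville N = -1} ∈ coNP := by
  show _ ∈ Nondeterministic.NP; simpa using liouvilleSign_compl_mem_NP true

/-- **`bin {N : λ(N) = 1} ∈ coNP`.** -/
theorem liouvillePos_mem_coNP :
    encodingNatBool.toLanguage {N : ℕ | ArithmeticFunction.liouville N = 1} ∈ coNP := by
  show _ ∈ Nondeterministic.NP; simpa using liouvilleSign_compl_mem_NP false

/-! ### Separation strength of the crux (and of the apex, which implies it) -/

/-- **The crux implies `NP ⊄ P/poly`.** -/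
theorem NP_not_subset_PPoly_of_liouvilleNotPPoly (h : LiouvilleNotPPoly) :
    ¬ Nondeterministic.NP ⊆ PPoly :=
  fun hsub => h (hsub liouville_mem_NP)

/-- **The crux implies `P ≠ NP`** in the prelude classes (tree theorem `P ⊆ P/poly`). -/
theorem P_ne_NP_of_liouvilleNotPPoly (h : LiouvilleNotPPoly) :
    (Classes.P : Set (Language Bool)) ≠ Nondeterministic.NP := fun hEq =>
  NP_not_subset_PPoly_of_liouvilleNotPPoly h (fun _ hL => P_subset_PPoly_holds (hEq ▸ hL))

/-- **The crux implies the summit `PneNP` of this hub, with `L_λ` itself as Cook's witness**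
(`L_λ ∈ NP`, `L_λ ∉ P ⊆ P/poly`, transported to Cook's Clay-model classes by the tree's bridges
`CookBridges.np_bool_eq`, `p_bool_eq`). -/
theorem pneNP_of_liouvilleNotPPoly : Summit.QuantumAdvantage.QuantumAdvantage.Theses.MobiusLadder.LiouvilleNotPPoly → PneNP := by
  intro h
  refine ⟨encodingNatBool.toLanguage {N : ℕ | ArithmeticFunction.liouville N = -1}, ?_, ?_⟩
  · rw [CookBridges.np_bool_eq]; exact liouville_mem_NP
  · rw [p_bool_eq]; exact fun hP => h (P_subset_PPoly_holds hP)

/-- Contrapositive, as the refutation surface reads it: `NP ⊆ P/poly` refutes the crux (and with it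
every apex of every line). -/
theorem liouville_mem_PPoly_of_NP_subset_PPoly (hsub : Nondeterministic.NP ⊆ PPoly) :
    encodingNatBool.toLanguage {N : ℕ | ArithmeticFunction.liouville N = -1} ∈ PPoly :=
  hsub liouville_mem_NP

end Summit.QuantumAdvantage.QuantumAdvantage.Theorems.LiouvilleNotPPoly

end
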